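import Mathlib
import Summits.AtomisticToContinuum.HydrodynamicLimit.Theorems.InformationPercolationEngineKickFairRelEquilibriumMesoLongKickGeometry
import Summits.AtomisticToContinuum.HydrodynamicLimit.Theorems.InformationPercolationEngineKickFairRelEquilibriumMesoTorusPacking
import Summits.AtomisticToContinuum.HydrodynamicLimit.Theorems.InformationPercolationEngineKickFairRelEquilibriumMesoClosePairAbstractCount
import Summits.AtomisticToContinuum.HydrodynamicLimit.Theorems.InformationPercolationEngineKickFairRelEquilibriumMesoSameWindowPairCovLongConst
import HarnessLib

/-!
# `KickFairRelEquilibriumMeso`, line `kinetic-window-cut` rev 5 — CPL, part 1: the PATHWISE close-pair count of long-flight kicks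

Prover file (`--supports stmt-AtomisticToContinuum-15177`, lead c8) towards the registered stub `stub_closePairCountLong : ClosePairCountLong rs`
of the skeleton `Cruxes/KickFairRelEquilibriumMeso/Lines/kinetic_window_cut.lean` (rev 5, the long-flight window cut). On the good set, with the
genuineness of the enumeration (`n < cnt_i → t_{i,n} ∈ (0, τ]`), the number of ordered same-window CLOSE pairs of long-flight kicks is bounded
DETERMINISTICALLY (registered sub-goal `closePairCountLong_pathwise`):

  `#{((i,n),(i',n')) : long, long, PairCloseL} ≤ (⌊τ/t_N⌋₊ + 1)(N+1)(A+1) · (⌈2A⌉₊ + 1) · (((14r + ε)/ε)³ + KE(z)/V²)`,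

`V = rA/t_N`, `ε = hsDiameter σ N`, `KE = kinEnergy` (twice the kinetic energy, conserved). Ingredients (all landed in wave 1 of lead c8):
* for a fixed long kick `(i,n)` the close partners `(i',n')` (long, same window, near-or-fast) inject by `(i', grid index of t_{i',n'})`
  (`gridIdx_add_two_le`: two long kicks of one sphere are `≥ t_N/A = 2m` apart) into `⋃_γ A_γ × {γ}` over the `≤ ⌈2A⌉ + 1` grid indices of
  the window (`gridIdx_window_bounds`), where `A_γ` = spheres within `7r` of the true collision point `x_i(t_{i,n})` at the grid time `mγ`
  or faster than `V` there (`flow_gridTime_anchorPt`, `euclidDist_collPt_predPt_le`: NEAR ⇒ within `r + 5r + r`; FAST ⇒ the velocity at the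
  grid time is the photo velocity) — `card_le_toNat_mul_of_grid`;
* `#A_γ ≤ ((14r+ε)/ε)³ + KE/V²`: torus packing of `ε`-separated centres (`card_filter_euclidDist_le`, the configuration at the grid time is in
  the hard-sphere domain by invariance of the good set) and Chebyshev on the conserved kinetic energy (`HardSphereFlow.configEnergy_flow`);
* the number of long kicks is `≤ (⌊τ/t_N⌋₊ + 1)(N+1)(A+1)` (`cutCount_of_diam` on the floor windows, `floorWindow_diam`).
Part 2 (`…MesoClosePairCountLong.lean`) integrates this bound against the local Gibbs law (energy-typical set + `localGibbsLaw_kinEnergy_tail`).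
-/

noncomputable section

open MeasureTheory Set Filter Topology
open scoped ENNReal Classical

namespace Summit.AtomisticToContinuum.HydrodynamicLimit.Theorems.KickFairRelEquilibriumMesoLine

open Literature.Analysis.FluidPDE Literature.MathematicalPhysics.KineticTheory

variable {σ : ℝ} {N : ℕ}

/-! ## Small facts -/

/-- `kinEnergy = 2 · configEnergy`. [folklore] -/
theorem kinEnergy_eq_two_mul_configEnergy (z : Phase N) : kinEnergy z = 2 * configEnergy z := by
  simp only [kinEnergy, configEnergy]
  ring

/-- The kinetic energy is conserved along good orbits. [folklore] -/
theorem kinEnergy_flow (Φ : Flow σ N) {z : Phase N} (hz : z ∈ Φ.good) (t : ℝ) : kinEnergy (Φ.flow t z) = kinEnergy z := by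
  rw [kinEnergy_eq_two_mul_configEnergy, kinEnergy_eq_two_mul_configEnergy, Φ.configEnergy_flow hz t]

/-- **Chebyshev on the kinetic energy**: the spheres faster than `V > 0` number at most `KE/V²`. [folklore] -/
theorem card_filter_fast_le (z : Phase N) {V : ℝ} (hV : 0 < V) :
    (((Finset.univ.filter fun j : Fin (N + 1) => V < ‖(z j).2‖).card : ℕ) : ℝ) ≤ kinEnergy z / V ^ 2 := by
  rw [le_div_iff₀ (by positivity), Finset.natCast_card_filter, Finset.sum_mul]
  unfold kinEnergy
  refine Finset.sum_le_sum fun j _ => ?_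
  split_ifs with h
  · rw [one_mul]
    exact pow_le_pow_left₀ hV.le h.le 2
  · rw [zero_mul]; positivity

/-- The number of grid indices available to one window: `⌈2A(v+1)⌉ − 1 + 1 − ⌈2Av − 1⌉ ≤ ⌈2A⌉₊ + 1`. [folklore] -/
theorem gridRange_toNat_le {A : ℝ} (hA : 0 < A) (v : ℤ) :
    ((⌈2 * A * ((v : ℝ) + 1)⌉ - 1) + 1 - ⌈2 * A * (v : ℝ) - 1⌉).toNat ≤ ⌈2 * A⌉₊ + 1 := by
  refine Int.toNat_le.2 ?_
  have h1 : ⌈2 * A * ((v : ℝ) + 1)⌉ ≤ ⌈2 * A * (v : ℝ)⌉ + ⌈2 * A⌉ := by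
    rw [show 2 * A * ((v : ℝ) + 1) = 2 * A * (v : ℝ) + 2 * A by ring]
    exact Int.ceil_add_le _ _
  have h2 : ⌈2 * A * (v : ℝ) - 1⌉ = ⌈2 * A * (v : ℝ)⌉ - 1 := Int.ceil_sub_one _
  have h3 : ((⌈2 * A⌉₊ : ℕ) : ℤ) = ⌈2 * A⌉ := Int.natCast_ceil_eq_ceil (by positivity)
  push_cast
  rw [h3]
  omega

/-! ## The long kicks are few (per sphere per window `≤ A+1`, pathwise) -/

/-- **The number of long-flight kicks in `(0, τ]` is at most `(⌊τ/t_N⌋₊ + 1)(N+1)(A+1)`, pathwise** on the good set, given the genuineness of the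
enumeration: bin the kicks by the floor windows meeting `(0, τ]` and use `cutCount_of_diam` in each. [folklore] -/
theorem longKickCount_le (Φ : Flow σ N) (τ r : ℝ) {A : ℝ} (hA : 0 < A) {z : Phase N} (hz : z ∈ Φ.good)
    (hgen : ∀ i : Fin (N + 1), ∀ n : ℕ, n < cnt Φ τ z i → Φ.nthCollisionTimeOf i n z ∈ Set.Ioc 0 τ) :
    ∑ i : Fin (N + 1), ∑ n ∈ Finset.range (cnt Φ τ z i), (if IsLong A (tN N) (past Φ r z i n) then (1 : ℝ) else 0) ≤
      ((⌊τ / tN N⌋₊ : ℝ) + 1) * (((N : ℝ) + 1) * (A + 1)) := by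
  have htN := tN_pos N
  have hwin : ∀ (i : Fin (N + 1)), ∀ n ∈ Finset.range (cnt Φ τ z i), (if IsLong A (tN N) (past Φ r z i n) then (1 : ℝ) else 0) ≤
      ∑ v ∈ Finset.range (⌊τ / tN N⌋₊ + 1),
        (if IsLong A (tN N) (past Φ r z i n) ∧ (past Φ r z i n).2.2.2 ∈ {x : ℝ | ((v : ℕ) : ℤ) = ⌊x / tN N⌋}
          then (1 : ℝ) else 0) := by
    intro i n hn
    have ht := hgen i n (Finset.mem_range.1 hn)
    have hpt : (past Φ r z i n).2.2.2 = Φ.nthCollisionTimeOf i n z := by simp [past, hz]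
    have ht0 : 0 ≤ Φ.nthCollisionTimeOf i n z / tN N := div_nonneg ht.1.le htN.le
    have hv₀mem : ⌊Φ.nthCollisionTimeOf i n z / tN N⌋₊ ∈ Finset.range (⌊τ / tN N⌋₊ + 1) :=
      Finset.mem_range.2 (Nat.lt_succ_of_le (Nat.floor_le_floor (div_le_div_of_nonneg_right ht.2 htN.le)))
    have hv₀ : ((⌊Φ.nthCollisionTimeOf i n z / tN N⌋₊ : ℕ) : ℤ) = ⌊Φ.nthCollisionTimeOf i n z / tN N⌋ :=
      Int.natCast_floor_eq_floor ht0
    have hmem : (past Φ r z i n).2.2.2 ∈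
        {x : ℝ | ((⌊Φ.nthCollisionTimeOf i n z / tN N⌋₊ : ℕ) : ℤ) = ⌊x / tN N⌋} := by
      rw [Set.mem_setOf_eq, hpt, hv₀]
    refine le_trans (le_of_eq ?_) (Finset.single_le_sum (fun v _ => ?_) hv₀mem)
    · simp only [hmem, and_true]
    · positivity
  calc ∑ i : Fin (N + 1), ∑ n ∈ Finset.range (cnt Φ τ z i), (if IsLong A (tN N) (past Φ r z i n) then (1 : ℝ) else 0)
      ≤ ∑ i : Fin (N + 1), ∑ n ∈ Finset.range (cnt Φ τ z i), ∑ v ∈ Finset.range (⌊τ / tN N⌋₊ + 1),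
          (if IsLong A (tN N) (past Φ r z i n) ∧ (past Φ r z i n).2.2.2 ∈ {x : ℝ | ((v : ℕ) : ℤ) = ⌊x / tN N⌋}
            then (1 : ℝ) else 0) := Finset.sum_le_sum fun i _ => Finset.sum_le_sum (hwin i)
    _ = ∑ v ∈ Finset.range (⌊τ / tN N⌋₊ + 1), ∑ i : Fin (N + 1), ∑ n ∈ Finset.range (cnt Φ τ z i),
          (if IsLong A (tN N) (past Φ r z i n) ∧ (past Φ r z i n).2.2.2 ∈ {x : ℝ | ((v : ℕ) : ℤ) = ⌊x / tN N⌋}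
            then (1 : ℝ) else 0) := by
        rw [Finset.sum_comm]
        exact Finset.sum_congr rfl fun i _ => Finset.sum_comm
    _ ≤ ∑ _v ∈ Finset.range (⌊τ / tN N⌋₊ + 1), ∑ _i : Fin (N + 1), (A + 1) := by
        refine Finset.sum_le_sum fun v _ => Finset.sum_le_sum fun i _ => ?_
        refine le_trans (le_of_eq (Finset.sum_congr rfl fun n _ => ?_))
          (cutCount_of_diam Φ τ r hA {x : ℝ | ((v : ℕ) : ℤ) = ⌊x / tN N⌋} (floorWindow_diam N _) hz i)
        exact @if_congr _ _ _ (_) (_) _ _ _ _ Iff.rfl rfl rfl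
    _ = ((⌊τ / tN N⌋₊ : ℝ) + 1) * (((N : ℝ) + 1) * (A + 1)) := by
        simp only [Finset.sum_const, Finset.card_univ, Fintype.card_fin, Finset.card_range, nsmul_eq_mul]
        push_cast
        ring

/-! ## The close partners of one long kick -/

/-- **THE CLOSE PARTNERS OF ONE LONG KICK ARE FEW.** On the good set (genuine enumeration, `7r + ε < 1/2`), for a long kick `(i, n)`: the long
kicks `(i', n')` in the same kinetic window that are near-or-fast w.r.t. `(i, n)` number at most
`(⌈2A⌉₊ + 1) · (⌊((14r+ε)/ε)³⌋₊ + ⌊KE/V²⌋₊)`, `V = rA/t_N`. [folklore] -/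
theorem closePartners_card_le (Φ : Flow σ N) (hσ : 0 < σ) (τ : ℝ) {r A : ℝ} (hr : 0 < r) (hA : 0 < A)
    (hroom : 7 * r + hsDiameter σ N < 1 / 2) {z : Phase N} (hz : z ∈ Φ.good)
    (hgen : ∀ i : Fin (N + 1), ∀ n : ℕ, n < cnt Φ τ z i → Φ.nthCollisionTimeOf i n z ∈ Set.Ioc 0 τ)
    (i : Fin (N + 1)) {n : ℕ} (hn : n < cnt Φ τ z i) :
    ((Finset.univ.sigma fun i' : Fin (N + 1) => (Finset.range (cnt Φ τ z i')).filter fun n' =>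
        IsLong A (tN N) (past Φ (r) z i' n') ∧
          PairCloseL r A (tN N) (past Φ r z i n) (past Φ r z i' n') i i').card : ℕ) ≤
      (⌈2 * A⌉₊ + 1) * (⌊((14 * r + hsDiameter σ N) / hsDiameter σ N) ^ 3⌋₊ + ⌊kinEnergy z / (r * A / tN N) ^ 2⌋₊) := by
  have htN := tN_pos N
  have hε := hsDiameter_pos hσ N
  have hV : 0 < r * A / tN N := by positivity
  set tw := tN N with htw
  set m := gridMesh A tw with hm
  -- times, the true collision point of `(i, n)`, the window of `(i, n)`
  set T : Fin (N + 1) → ℕ → ℝ := fun j k => Φ.nthCollisionTimeOf j k z with hT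
  have hpt : ∀ j k, (past Φ r z j k).2.2.2 = T j k := fun j k => by simp [past, hz, hT]
  have hps : ∀ j k, (past Φ r z j k).2.1 =
      flightStart (Torus.geometry (Fin 3)) (hsDiameter σ N) (fun s => Φ.flow s z) 0 j (T j k) := fun j k => by simp [past, hz, hT]
  set xc : T3 := ((Φ.flow (T i n) z) i).1 with hxc
  set v : ℤ := ⌊T i n / tw⌋ with hv
  have hTin : 0 ≤ T i n := (hgen i n hn).1.le
  -- the target family `A_γ`: spheres within `7r` of `xc` at the grid time `mγ`, or faster than `V` there
  set Aγ : ℤ → Finset (Fin (N + 1)) := fun γ => Finset.univ.filter fun j : Fin (N + 1) =>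
    Torus.euclidDist ((Φ.flow (m * (γ : ℝ)) z) j).1 xc ≤ 7 * r ∨ r * A / tN N < ‖((Φ.flow (m * (γ : ℝ)) z) j).2‖ with hAγ
  -- the set of close partners
  set S := Finset.univ.sigma fun i' : Fin (N + 1) => (Finset.range (cnt Φ τ z i')).filter fun n' =>
    IsLong A (tN N) (past Φ r z i' n') ∧ PairCloseL r A (tN N) (past Φ r z i n) (past Φ r z i' n') i i' with hS
  have hmemS : ∀ {p : Σ _ : Fin (N + 1), ℕ}, p ∈ S → p.2 < cnt Φ τ z p.1 ∧ IsLong A tw (past Φ r z p.1 p.2) ∧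
      ⌊T i n / tw⌋ = ⌊T p.1 p.2 / tw⌋ ∧ NearOrFast r A tw (past Φ r z i n) (past Φ r z p.1 p.2) i p.1 := by
    intro p hp
    rcases Finset.mem_sigma.1 hp with ⟨-, hp2⟩
    rcases Finset.mem_filter.1 hp2 with ⟨hrg, hL, hsw, hnf⟩
    refine ⟨Finset.mem_range.1 hrg, hL, ?_, hnf⟩
    have := hsw
    simp only [SameWindow, hpt] at this
    exact this
  -- long ⇒ flight facts at the grid time
  have hflight : ∀ {p : Σ _ : Fin (N + 1), ℕ}, p ∈ S →
      Torus.euclidDist ((Φ.flow (gridTime A tw (T p.1 p.2)) z) p.1).1 (anchorPt r A tw (past Φ r z p.1 p.2) p.1) ≤ r ∧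
        ((Φ.flow (gridTime A tw (T p.1 p.2)) z) p.1).2 = ((past Φ r z p.1 p.2).1.1.1 p.1).2 := by
    intro p hp
    obtain ⟨hc, hL, -, -⟩ := hmemS hp
    have h := flow_gridTime_anchorPt σ N Φ r A hσ hr hA z hz p.1 p.2 (hgen p.1 p.2 hc).1.le hL
    exact ⟨h.2.2.1, h.2.2.2⟩
  -- apply the grid-injection count with sphere `p.1`, index `gridIdx (T p)`, window range of `v`
  have key := card_le_toNat_mul_of_grid S (fun p => p.1) (fun p => gridIdx A tw (T p.1 p.2)) Aγ
    ⌈2 * A * (v : ℝ) - 1⌉ (⌈2 * A * ((v : ℝ) + 1)⌉ - 1)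
    (⌊((14 * r + hsDiameter σ N) / hsDiameter σ N) ^ 3⌋₊ + ⌊kinEnergy z / (r * A / tN N) ^ 2⌋₊) ?_ ?_ ?_ ?_
  · exact key.trans (Nat.mul_le_mul_right _ (gridRange_toNat_le hA v))
  · -- injectivity: two long kicks of one sphere have grid indices differing by ≥ 2
    intro p hp p' hp' hsph hidx
    obtain ⟨hc, -, -, -⟩ := hmemS hp
    obtain ⟨hc', -, -, -⟩ := hmemS hp'
    have hL := (hmemS hp).2.1
    have hL' := (hmemS hp').2.1
    rcases p with ⟨j, k⟩
    rcases p' with ⟨j', k'⟩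
    simp only at hsph hidx hc hc' hL hL'
    subst hsph
    -- collision times of `j`
    set Sj : Set ℝ := collisionTimesOf (Torus.geometry (Fin 3)) (hsDiameter σ N) (fun s => Φ.flow s z) j with hSj
    have htraj := Φ.isTrajectory z hz
    have hmono : ∀ ⦃a b : ℕ⦄, a < cnt Φ τ z j → b < cnt Φ τ z j → a < b → T j a < T j b := fun a b ha hb hab =>
      strictMonoOn_nthTimeAfter_of_ncard (S := Sj) (a := 0) (b := τ) ha hb hab
    -- a long kick `b` after a kick `a` of the same sphere is `≥ tw/A` later
    have hsep : ∀ {a b : ℕ}, a < cnt Φ τ z j → b < cnt Φ τ z j → a < b → IsLong A tw (past Φ r z j b) →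
        tw / A ≤ T j b - T j a := by
      intro a b ha hb hab hLb
      have hmem : nthTimeAfter Sj 0 a ∈ Sj ∩ Ioc 0 τ := nthTimeAfter_mem_of_lt_ncard (S := Sj) (a := 0) (b := τ) ha
      have hfs : T j a ≤ flightStart (Torus.geometry (Fin 3)) (hsDiameter σ N) (fun s => Φ.flow s z) 0 j (T j b) :=
        le_flightStart_of_mem (htraj.finite_collisionTimesOf_inter_Ioo j 0 _) hmem.1 hmem.2.1 (hmono ha hb hab)
      have : tw / A ≤ T j b - flightStart (Torus.geometry (Fin 3)) (hsDiameter σ N) (fun s => Φ.flow s z) 0 j (T j b) := by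
        have h := hLb
        simp only [IsLong, hpt, hps] at h
        exact h
      linarith
    rcases lt_trichotomy k k' with hlt | heq | hgt
    · have h2 := gridIdx_add_two_le A tw (T j k) (T j k') hA htN (hsep hc hc' hlt hL')
      omega
    · subst heq; rfl
    · have h2 := gridIdx_add_two_le A tw (T j k') (T j k) hA htN (hsep hc' hc hgt hL)
      omega
  · -- the grid index of a same-window kick lies in the window's integer range
    intro p hp
    obtain ⟨-, -, hsw, -⟩ := hmemS hp
    have hb := gridIdx_window_bounds A tw (T p.1 p.2) hA htN
    rw [← hsw] at hb
    constructor
    · exact Int.ceil_le.2 hb.1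
    · have : gridIdx A tw (T p.1 p.2) < ⌈2 * A * ((v : ℝ) + 1)⌉ := Int.lt_ceil.2 hb.2
      omega
  · -- membership: at the grid time the partner sphere is within `7r` of `xc`, or fast
    intro p hp
    obtain ⟨hc, hL, -, hnf⟩ := hmemS hp
    obtain ⟨hdist, hvel⟩ := hflight hp
    have hgt : gridTime A tw (T p.1 p.2) = m * ((gridIdx A tw (T p.1 p.2) : ℤ) : ℝ) := rfl
    simp only [hAγ, Finset.mem_filter, Finset.mem_univ, true_and]
    rw [← hgt]
    rcases hnf with hnear | hfast
    · left
      have h1 := euclidDist_collPt_predPt_le σ N Φ r hσ hr z hz i n hTin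
      -- d(x_{i'}(u), xc) ≤ d(x_{i'}(u), anchor) + d(anchor, predPt) + d(predPt, xc)
      calc Torus.euclidDist ((Φ.flow (gridTime A tw (T p.1 p.2)) z) p.1).1 xc
          ≤ Torus.euclidDist ((Φ.flow (gridTime A tw (T p.1 p.2)) z) p.1).1 (anchorPt r A tw (past Φ r z p.1 p.2) p.1) +
              Torus.euclidDist (anchorPt r A tw (past Φ r z p.1 p.2) p.1) xc := torus_euclidDist_triangle _ _ _
        _ ≤ r + (Torus.euclidDist (anchorPt r A tw (past Φ r z p.1 p.2) p.1) (predPt r (past Φ r z i n) i) +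
              Torus.euclidDist (predPt r (past Φ r z i n) i) xc) := add_le_add hdist (torus_euclidDist_triangle _ _ _)
        _ ≤ r + (5 * r + r) := by
            gcongr
            · rw [Torus.euclidDist_comm]; exact hnear
            · rw [Torus.euclidDist_comm]; exact h1
        _ = 7 * r := by ring
    · right
      rw [hvel]
      exact hfast
  · -- cardinality of `A_γ`: packing + Chebyshev
    intro γ _
    have hgood : Φ.flow (m * (γ : ℝ)) z ∈ Φ.good := Φ.mapsTo_good _ hz
    have hdom := Φ.good_subset hgood
    have hunion : Aγ γ ⊆ (Finset.univ.filter fun j : Fin (N + 1) => Torus.euclidDist ((Φ.flow (m * (γ : ℝ)) z) j).1 xc ≤ 7 * r) ∪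
        (Finset.univ.filter fun j : Fin (N + 1) => r * A / tN N < ‖((Φ.flow (m * (γ : ℝ)) z) j).2‖) := by
      intro j hj
      simp only [hAγ, Finset.mem_filter, Finset.mem_univ, true_and] at hj
      rcases hj with h | h
      · exact Finset.mem_union_left _ (Finset.mem_filter.2 ⟨Finset.mem_univ _, h⟩)
      · exact Finset.mem_union_right _ (Finset.mem_filter.2 ⟨Finset.mem_univ _, h⟩)
    refine (Finset.card_le_card hunion).trans ((Finset.card_union_le _ _).trans (add_le_add ?_ ?_))
    · refine Nat.le_floor ?_
      have h := card_filter_euclidDist_le N (hsDiameter σ N) (7 * r) hε (by positivity) hroom (Φ.flow (m * (γ : ℝ)) z) hdom xc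
      have h14 : 2 * (7 * r) + hsDiameter σ N = 14 * r + hsDiameter σ N := by ring
      rw [h14] at h
      exact h
    · refine Nat.le_floor ?_
      have h := card_filter_fast_le (Φ.flow (m * (γ : ℝ)) z) hV
      rwa [kinEnergy_flow Φ hz] at h

/-! ## The registered sub-goal: the pathwise close-pair count -/

/-- **STUB `closePairCountLong_pathwise` — THE PATHWISE CLOSE-PAIR COUNT OF LONG-FLIGHT KICKS** (registered sub-goal of the line `kinetic-window-cut`,
rev 5). On the good set, given the genuineness of the enumeration and the chart room `7r + ε < 1/2`:
`ΣΣΣΣ 1_{L ∧ L' ∧ PairCloseL} ≤ (⌊τ/t_N⌋₊ + 1)(N+1)(A+1) · (⌈2A⌉₊ + 1) · (((14r+ε)/ε)³ + KE(z)/(rA/t_N)²)` and `≤ ((⌊τ/t_N⌋₊ + 1)(N+1)(A+1))²`.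
[folklore] -/
theorem closePairCountLong_pathwise : ∀ (σ : ℝ) (N : ℕ) (Φ : Flow σ N) (τ r A : ℝ), 0 < σ → 0 < r → 0 < A →
    7 * r + hsDiameter σ N < 1 / 2 → ∀ z : Phase N, z ∈ Φ.good →
    (∀ i : Fin (N + 1), ∀ n : ℕ, n < cnt Φ τ z i → Φ.nthCollisionTimeOf i n z ∈ Set.Ioc 0 τ) →
    ∑ i : Fin (N + 1), ∑ n ∈ Finset.range (cnt Φ τ z i), ∑ i' : Fin (N + 1), ∑ n' ∈ Finset.range (cnt Φ τ z i'),
        (if IsLong A (tN N) (past Φ r z i n) ∧ IsLong A (tN N) (past Φ r z i' n') ∧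
            PairCloseL r A (tN N) (past Φ r z i n) (past Φ r z i' n') i i' then (1 : ℝ) else 0) ≤
      min (((⌊τ / tN N⌋₊ : ℝ) + 1) * (((N : ℝ) + 1) * (A + 1)) *
          (((⌈2 * A⌉₊ : ℝ) + 1) * (((14 * r + hsDiameter σ N) / hsDiameter σ N) ^ 3 + kinEnergy z / (r * A / tN N) ^ 2)))
        ((((⌊τ / tN N⌋₊ : ℝ) + 1) * (((N : ℝ) + 1) * (A + 1))) ^ 2) := by
  intro σ N Φ τ r A hσ hr hA hroom z hz hgen
  have htN := tN_pos N
  have hε := hsDiameter_pos hσ N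
  set L : Fin (N + 1) → ℕ → ℝ := fun i n => if IsLong A (tN N) (past Φ r z i n) then (1 : ℝ) else 0 with hLdef
  set X : ℝ := ((14 * r + hsDiameter σ N) / hsDiameter σ N) ^ 3 with hX
  set Q : ℝ := kinEnergy z / (r * A / tN N) ^ 2 with hQ
  have hX0 : 0 ≤ X := by positivity
  have hKE0 : 0 ≤ kinEnergy z := Finset.sum_nonneg fun i _ => by positivity
  have hQ0 : 0 ≤ Q := by positivity
  have hL0 : ∀ i n, 0 ≤ L i n := fun i n => by simp only [hLdef]; positivity
  have hL1 : ∀ i n, L i n ≤ 1 := fun i n => by simp only [hLdef]; split_ifs <;> norm_num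
  have hcountL := longKickCount_le Φ τ r hA hz hgen
  -- the inner sum of a fixed kick, two ways
  have hinner : ∀ (i : Fin (N + 1)), ∀ n ∈ Finset.range (cnt Φ τ z i),
      ∑ i' : Fin (N + 1), ∑ n' ∈ Finset.range (cnt Φ τ z i'),
        (if IsLong A (tN N) (past Φ r z i n) ∧ IsLong A (tN N) (past Φ r z i' n') ∧
            PairCloseL r A (tN N) (past Φ r z i n) (past Φ r z i' n') i i' then (1 : ℝ) else 0) ≤
      min (L i n * (((⌈2 * A⌉₊ : ℝ) + 1) * (X + Q)))
        (L i n * ∑ i' : Fin (N + 1), ∑ n' ∈ Finset.range (cnt Φ τ z i'), L i' n') := by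
    intro i n hn
    by_cases hL : IsLong A (tN N) (past Φ r z i n)
    · have h1 : L i n = 1 := by simp only [hLdef, hL, if_true]
      rw [h1, one_mul, one_mul]
      refine le_min ?_ (Finset.sum_le_sum fun i' _ => Finset.sum_le_sum fun n' _ => ?_)
      · -- the count of close partners
        have hcard := closePartners_card_le Φ hσ τ hr hA hroom hz hgen i (Finset.mem_range.1 hn)
        have heq : ∑ i' : Fin (N + 1), ∑ n' ∈ Finset.range (cnt Φ τ z i'),
            (if IsLong A (tN N) (past Φ r z i n) ∧ IsLong A (tN N) (past Φ r z i' n') ∧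
                PairCloseL r A (tN N) (past Φ r z i n) (past Φ r z i' n') i i' then (1 : ℝ) else 0) =
            (((Finset.univ.sigma fun i' : Fin (N + 1) => (Finset.range (cnt Φ τ z i')).filter fun n' =>
              IsLong A (tN N) (past Φ r z i' n') ∧
                PairCloseL r A (tN N) (past Φ r z i n) (past Φ r z i' n') i i').card : ℕ) : ℝ) := by
          rw [Finset.card_sigma, Nat.cast_sum]
          refine Finset.sum_congr rfl fun i' _ => ?_
          rw [Finset.natCast_card_filter]
          refine Finset.sum_congr rfl fun n' _ => ?_
          simp only [hL, true_and]
        rw [heq]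
        calc (((Finset.univ.sigma fun i' : Fin (N + 1) => (Finset.range (cnt Φ τ z i')).filter fun n' =>
              IsLong A (tN N) (past Φ r z i' n') ∧
                PairCloseL r A (tN N) (past Φ r z i n) (past Φ r z i' n') i i').card : ℕ) : ℝ)
            ≤ (((⌈2 * A⌉₊ + 1) * (⌊X⌋₊ + ⌊Q⌋₊) : ℕ) : ℝ) := by exact_mod_cast hcard
          _ ≤ ((⌈2 * A⌉₊ : ℝ) + 1) * (X + Q) := by
              push_cast
              gcongr
              · exact Nat.floor_le hX0
              · exact Nat.floor_le hQ0
      · split_ifs with h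
        · simp only [hLdef, h.2.1, if_true, le_refl]
        · exact hL0 i' n'
    · have h0 : L i n = 0 := by simp only [hLdef, hL, if_false]
      rw [h0, zero_mul, zero_mul, min_self]
      refine le_of_eq (Finset.sum_eq_zero fun i' _ => Finset.sum_eq_zero fun n' _ => ?_)
      rw [if_neg (fun h => hL h.1)]
  have hW0 : 0 ≤ ((⌊τ / tN N⌋₊ : ℝ) + 1) * (((N : ℝ) + 1) * (A + 1)) := by positivity
  have hsumL0 : 0 ≤ ∑ i : Fin (N + 1), ∑ n ∈ Finset.range (cnt Φ τ z i), L i n :=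
    Finset.sum_nonneg fun i _ => Finset.sum_nonneg fun n _ => hL0 i n
  refine le_min ?_ ?_
  · calc ∑ i : Fin (N + 1), ∑ n ∈ Finset.range (cnt Φ τ z i), ∑ i' : Fin (N + 1), ∑ n' ∈ Finset.range (cnt Φ τ z i'),
          (if IsLong A (tN N) (past Φ r z i n) ∧ IsLong A (tN N) (past Φ r z i' n') ∧
              PairCloseL r A (tN N) (past Φ r z i n) (past Φ r z i' n') i i' then (1 : ℝ) else 0)
        ≤ ∑ i : Fin (N + 1), ∑ n ∈ Finset.range (cnt Φ τ z i), L i n * (((⌈2 * A⌉₊ : ℝ) + 1) * (X + Q)) :=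
          Finset.sum_le_sum fun i _ => Finset.sum_le_sum fun n hn => (hinner i n hn).trans (min_le_left _ _)
      _ = (∑ i : Fin (N + 1), ∑ n ∈ Finset.range (cnt Φ τ z i), L i n) * (((⌈2 * A⌉₊ : ℝ) + 1) * (X + Q)) := by
          rw [Finset.sum_mul]
          exact Finset.sum_congr rfl fun i _ => (Finset.sum_mul _ _ _).symm
      _ ≤ ((⌊τ / tN N⌋₊ : ℝ) + 1) * (((N : ℝ) + 1) * (A + 1)) * (((⌈2 * A⌉₊ : ℝ) + 1) * (X + Q)) :=
          mul_le_mul_of_nonneg_right hcountL (by positivity)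
  · calc ∑ i : Fin (N + 1), ∑ n ∈ Finset.range (cnt Φ τ z i), ∑ i' : Fin (N + 1), ∑ n' ∈ Finset.range (cnt Φ τ z i'),
          (if IsLong A (tN N) (past Φ r z i n) ∧ IsLong A (tN N) (past Φ r z i' n') ∧
              PairCloseL r A (tN N) (past Φ r z i n) (past Φ r z i' n') i i' then (1 : ℝ) else 0)
        ≤ ∑ i : Fin (N + 1), ∑ n ∈ Finset.range (cnt Φ τ z i),
            L i n * ∑ i' : Fin (N + 1), ∑ n' ∈ Finset.range (cnt Φ τ z i'), L i' n' :=
          Finset.sum_le_sum fun i _ => Finset.sum_le_sum fun n hn => (hinner i n hn).trans (min_le_right _ _)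
      _ = (∑ i : Fin (N + 1), ∑ n ∈ Finset.range (cnt Φ τ z i), L i n) *
            ∑ i' : Fin (N + 1), ∑ n' ∈ Finset.range (cnt Φ τ z i'), L i' n' := by
          rw [Finset.sum_mul]
          exact Finset.sum_congr rfl fun i _ => (Finset.sum_mul _ _ _).symm
      _ ≤ (((⌊τ / tN N⌋₊ : ℝ) + 1) * (((N : ℝ) + 1) * (A + 1))) * (((⌊τ / tN N⌋₊ : ℝ) + 1) * (((N : ℝ) + 1) * (A + 1))) :=
          mul_le_mul hcountL hcountL hsumL0 hW0
      _ = (((⌊τ / tN N⌋₊ : ℝ) + 1) * (((N : ℝ) + 1) * (A + 1))) ^ 2 := by ring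

end Summit.AtomisticToContinuum.HydrodynamicLimit.Theorems.KickFairRelEquilibriumMesoLine

end
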